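import Summits.ValiantsHypothesis.ValiantsHypothesis.Theorems.LacunarySymmetroidMatrixDescartesCensusDoorA34NodeChambers

/-!
# `MatrixDescartes` census — DOOR A at `(3,4)`: the FACE LAWS of a four-node net at its det-roots

HONEST FRAMING.  Object-search cell `pub-symmetroid`, door-A seat `val-sym-door-p3` (g26); item stmt-ValiantsHypothesis-19980
`DoorA34 = PosRootLawAt 3 4 18` (route item `Theses.LacunarySymmetroid.DoorA34`) is OPEN and asserted nowhere in this file.
Helper identities in NODE currency (the tree's `…CensusDoorA34NodeForm`: a net spanned by four rank-one letters has
`det F(t) = K_c(ℓ(t)) := ∑ᵢ cᵢ ∏_{j ≠ i} ℓⱼ(t)` with squared weights `cᵢ = Cᵢ²` and four node `K`-nomials `ℓᵢ` on the common support;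
the door itself is `…NodeRows.doorA34_iff_nodeRows`).  For ALL supports and ALL real data, with no `def`:

* THE FOUR FACE FORMS.  `face_m(ℓ) := ∑_{i ≠ m} cᵢ ∏_{j ∉ {i,m}} ℓⱼ` is the node sum ONE FORMAT DOWN (three nodes, format `(2,4)`,
  Descartes ceiling `9`).  `compression_det_eq_faceForm` identifies it with a MATRIX OBJECT: for two vectors `p, p'` orthogonal to the
  node vector `v₃`, the `2 × 2` compression of `F = ∑ᵢ ℓᵢ • vᵢvᵢᵀ` to the plane `⟨p, p'⟩` has determinant
  `(pᵀFp)(p'ᵀFp') − (pᵀFp')² = ∑_{i<j≤2} ℓᵢℓⱼ ((p·vᵢ)(p'·vⱼ) − (p·vⱼ)(p'·vᵢ))²` — the face form opposite the node `v₃` with squared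
  weights (Lagrange / Cauchy–Binet identity `compression_det_sum_four_rankOne` for arbitrary `p, p'`).  So the four faces are the
  determinants of the restrictions of the pencil `F(t)` to the four node-orthogonal planes `v_m^⊥`: four genuine real symmetric
  `2 × 2` four-term pencils carried by every four-node net.
* FACE LAW I (`faceForm_mul_sq`): `face₀(ℓ) · ℓ₀² = K_c(ℓ) · ℓ₀ − c₀ · ℓ₀ℓ₁ℓ₂ℓ₃` (a `ring` identity; the weighted form of
  `e₂(ℓ₁,ℓ₂,ℓ₃) = ℓ₀² − e₁ℓ₀ + e₂` read through `∏(t − ℓᵢ)` at `t = ℓ₀`).  AT A DET-ROOT (`K_c(ℓ(t)) = 0`) therefore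
  `face₀ · ℓ₀² = −c₀ · e₄(ℓ)` (`faceForm_mul_sq_of_root`): with `c₀ > 0` and `ℓ₀(t) ≠ 0` the face form opposite EVERY node is non-zero
  and has the sign of `−ℓ₀ℓ₁ℓ₂ℓ₃(t)` (`faceForm_neg_of_root`, `faceForm_pos_of_root`) — all four faces agree in sign, negative
  (the restriction of `F(t)` to each node plane is INDEFINITE) in the even node chambers and positive (each restriction DEFINITE) in the
  odd ones.  This is the face-level sharpening of the node type law `…NodeTypeLaw` (odd chamber ⟺ `F(t)` semidefinite at the root).
* FACE LAW II (`faceForm_pair`): two faces sharing the edge `{0,1}` multiply to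
  `face₃ · face₂ = (c₁ℓ₀ + c₀ℓ₁) · K_c(ℓ) + c₂c₃ · ℓ₀²ℓ₁²`; at a det-root `face₂ · face₃ = c₂c₃ ℓ₀²ℓ₁² ≥ 0` (`faceForm_pair_of_root`),
  and off the walls the two faces have the same sign with the explicit product (`faceForm_pair_pos_of_root`).
* THE THREE-NODE CHART (`threeNodeChart`): `c₀² · K_c(ℓ) = L₁L₂L₃ − ℓ₀² · Λ` with the shifted node forms `Lᵢ = c₀ℓᵢ + cᵢℓ₀` and the
  single form `Λ = c₂c₃L₁ + c₁c₃L₂ + c₁c₂L₃ − 2c₁c₂c₃ℓ₀` — Cayley's cubic written as «product of three `K`-nomials minus `ℓ₀²` times ONE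
  `K`-nomial», i.e. as the member `λ = Λ` of the linear family `{L₁L₂L₃ − ℓ₀²·λ : λ a K-nomial}` of cubics singular at the three nodes
  `v₁, v₂, v₃` (partial degree `≤ 1` in `L₁, L₂, L₃`); the fourth node is the one condition «`λ` is this `Λ`».  At a det-root,
  `L₁L₂L₃ = ℓ₀²Λ` (`threeNodeChart_of_root`): the product of the three shifted node forms has the sign of the single form `Λ`.

Nothing here bounds `ζ_sym(3,4)`; `DoorA34` stays OPEN; registers unchanged; nothing bears on `MatrixDescartes`
(stmt-ValiantsHypothesis-18050) or on `VP ≠ VNP`.  [folklore] Newton/Vieta identities for `e_k` of four numbers, the Lagrange identity;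
Cayley's four-nodal cubic (Cayley 1869); elementary.
-/

-- `Summit.ValiantsHypothesis.ValiantsHypothesis.…` repeats a component by the D-0017 layout
-- (single-conjunct summit), which the `dupNamespace` linter flags; the name is mandated.
set_option linter.dupNamespace false

namespace Summit.ValiantsHypothesis.ValiantsHypothesis.Theorems.LacunarySymmetroidMatrixDescartes.Census.NodeFaces

open Finset
open scoped BigOperators Matrix

/-! ## 1. The faces are the `2 × 2` compressions to the node-orthogonal planes -/

/-- Bilinear form of a four-rank-one sum: `xᵀ (∑ᵢ ℓᵢ • vᵢvᵢᵀ) y = ∑ᵢ ℓᵢ (vᵢ·x)(vᵢ·y)`. [folklore] -/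
theorem bilinForm_sum_four_rankOne (v : Fin 4 → Fin 3 → ℝ) (ℓ : Fin 4 → ℝ) (x y : Fin 3 → ℝ) :
    x ⬝ᵥ ((∑ i, ℓ i • Matrix.vecMulVec (v i) (v i)) *ᵥ y) = ∑ i, ℓ i * ((v i ⬝ᵥ x) * (v i ⬝ᵥ y)) := by
  simp only [Matrix.mulVec, dotProduct, Matrix.sum_apply, Matrix.smul_apply, Matrix.vecMulVec_apply, smul_eq_mul,
    Fin.sum_univ_three, Fin.sum_univ_four]
  ring

/-- **Lagrange / Cauchy–Binet identity for a `2 × 2` compression.**  For `F = ∑ᵢ ℓᵢ • vᵢvᵢᵀ` and ANY two vectors `p, p'`,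
`(pᵀFp)(p'ᵀFp') − (pᵀFp')² = ∑_{i<j} ℓᵢℓⱼ ((p·vᵢ)(p'·vⱼ) − (p·vⱼ)(p'·vᵢ))²` (six terms, squared `2 × 2` minors as weights):
the determinant of the compression of the pencil to the plane `⟨p, p'⟩` is a `(2,4)`-type node sum in the same node forms. [folklore] -/
theorem compression_det_sum_four_rankOne (v : Fin 4 → Fin 3 → ℝ) (ℓ : Fin 4 → ℝ) (p p' : Fin 3 → ℝ) :
    (p ⬝ᵥ ((∑ i, ℓ i • Matrix.vecMulVec (v i) (v i)) *ᵥ p)) * (p' ⬝ᵥ ((∑ i, ℓ i • Matrix.vecMulVec (v i) (v i)) *ᵥ p'))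
        - (p ⬝ᵥ ((∑ i, ℓ i • Matrix.vecMulVec (v i) (v i)) *ᵥ p')) ^ 2 =
      ℓ 0 * ℓ 1 * ((v 0 ⬝ᵥ p) * (v 1 ⬝ᵥ p') - (v 1 ⬝ᵥ p) * (v 0 ⬝ᵥ p')) ^ 2
      + ℓ 0 * ℓ 2 * ((v 0 ⬝ᵥ p) * (v 2 ⬝ᵥ p') - (v 2 ⬝ᵥ p) * (v 0 ⬝ᵥ p')) ^ 2
      + ℓ 0 * ℓ 3 * ((v 0 ⬝ᵥ p) * (v 3 ⬝ᵥ p') - (v 3 ⬝ᵥ p) * (v 0 ⬝ᵥ p')) ^ 2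
      + ℓ 1 * ℓ 2 * ((v 1 ⬝ᵥ p) * (v 2 ⬝ᵥ p') - (v 2 ⬝ᵥ p) * (v 1 ⬝ᵥ p')) ^ 2
      + ℓ 1 * ℓ 3 * ((v 1 ⬝ᵥ p) * (v 3 ⬝ᵥ p') - (v 3 ⬝ᵥ p) * (v 1 ⬝ᵥ p')) ^ 2
      + ℓ 2 * ℓ 3 * ((v 2 ⬝ᵥ p) * (v 3 ⬝ᵥ p') - (v 3 ⬝ᵥ p) * (v 2 ⬝ᵥ p')) ^ 2 := by
  rw [bilinForm_sum_four_rankOne, bilinForm_sum_four_rankOne, bilinForm_sum_four_rankOne]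
  simp only [Fin.sum_univ_four]
  ring

/-- **The face opposite a node IS the compression to its orthogonal plane.**  If `p` and `p'` are orthogonal to the node vector `v₃`,
the compression determinant of `F = ∑ᵢ ℓᵢ • vᵢvᵢᵀ` to `⟨p, p'⟩` is the THREE-node sum in `ℓ₀, ℓ₁, ℓ₂` alone:
`∑_{i<j≤2} wᵢⱼ ℓᵢℓⱼ` with squared weights — the face form opposite the node `3` (and likewise for every node). [folklore] -/
theorem compression_det_eq_faceForm (v : Fin 4 → Fin 3 → ℝ) (ℓ : Fin 4 → ℝ) (p p' : Fin 3 → ℝ)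
    (hp : v 3 ⬝ᵥ p = 0) (hp' : v 3 ⬝ᵥ p' = 0) :
    (p ⬝ᵥ ((∑ i, ℓ i • Matrix.vecMulVec (v i) (v i)) *ᵥ p)) * (p' ⬝ᵥ ((∑ i, ℓ i • Matrix.vecMulVec (v i) (v i)) *ᵥ p'))
        - (p ⬝ᵥ ((∑ i, ℓ i • Matrix.vecMulVec (v i) (v i)) *ᵥ p')) ^ 2 =
      ℓ 0 * ℓ 1 * ((v 0 ⬝ᵥ p) * (v 1 ⬝ᵥ p') - (v 1 ⬝ᵥ p) * (v 0 ⬝ᵥ p')) ^ 2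
      + ℓ 0 * ℓ 2 * ((v 0 ⬝ᵥ p) * (v 2 ⬝ᵥ p') - (v 2 ⬝ᵥ p) * (v 0 ⬝ᵥ p')) ^ 2
      + ℓ 1 * ℓ 2 * ((v 1 ⬝ᵥ p) * (v 2 ⬝ᵥ p') - (v 2 ⬝ᵥ p) * (v 1 ⬝ᵥ p')) ^ 2 := by
  rw [compression_det_sum_four_rankOne, hp, hp']
  ring

/-! ## 2. Face law I: `face₀ · ℓ₀² = K_c · ℓ₀ − c₀ · e₄` -/

/-- **FACE LAW I** (a `ring` identity).  With the four-node sum `K_c(ℓ) = c₀ℓ₁ℓ₂ℓ₃ + c₁ℓ₀ℓ₂ℓ₃ + c₂ℓ₀ℓ₁ℓ₃ + c₃ℓ₀ℓ₁ℓ₂` and the face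
form opposite node `0`, `face₀ = c₁ℓ₂ℓ₃ + c₂ℓ₁ℓ₃ + c₃ℓ₁ℓ₂`:  `face₀ · ℓ₀² = K_c · ℓ₀ − c₀ · ℓ₀ℓ₁ℓ₂ℓ₃`.  (For unit weights this is
`e₂(ℓ₁,ℓ₂,ℓ₃)ℓ₀² = e₃ℓ₀ − e₄`, i.e. `∏ᵢ(t − ℓᵢ)` at `t = ℓ₀`.) [folklore] -/
theorem faceForm_mul_sq (c₀ c₁ c₂ c₃ ℓ₀ ℓ₁ ℓ₂ ℓ₃ : ℝ) :
    (c₁ * (ℓ₂ * ℓ₃) + c₂ * (ℓ₁ * ℓ₃) + c₃ * (ℓ₁ * ℓ₂)) * ℓ₀ ^ 2 =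
      (c₀ * (ℓ₁ * ℓ₂ * ℓ₃) + c₁ * (ℓ₀ * ℓ₂ * ℓ₃) + c₂ * (ℓ₀ * ℓ₁ * ℓ₃) + c₃ * (ℓ₀ * ℓ₁ * ℓ₂)) * ℓ₀
        - c₀ * (ℓ₀ * ℓ₁ * ℓ₂ * ℓ₃) := by
  ring

/-- At a det-root (`K_c(ℓ) = 0`): `face₀ · ℓ₀² = −c₀ · ℓ₀ℓ₁ℓ₂ℓ₃`. [folklore] -/
theorem faceForm_mul_sq_of_root (c₀ c₁ c₂ c₃ ℓ₀ ℓ₁ ℓ₂ ℓ₃ : ℝ)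
    (hK : c₀ * (ℓ₁ * ℓ₂ * ℓ₃) + c₁ * (ℓ₀ * ℓ₂ * ℓ₃) + c₂ * (ℓ₀ * ℓ₁ * ℓ₃) + c₃ * (ℓ₀ * ℓ₁ * ℓ₂) = 0) :
    (c₁ * (ℓ₂ * ℓ₃) + c₂ * (ℓ₁ * ℓ₃) + c₃ * (ℓ₁ * ℓ₂)) * ℓ₀ ^ 2 = -(c₀ * (ℓ₀ * ℓ₁ * ℓ₂ * ℓ₃)) := by
  rw [faceForm_mul_sq, hK, zero_mul, zero_sub]

/-- **All faces negative in an even chamber.**  At a det-root with `c₀ > 0`, `ℓ₀ ≠ 0` and `ℓ₀ℓ₁ℓ₂ℓ₃ > 0` (two or no negative node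
values), the face form opposite node `0` is NEGATIVE — by `compression_det_eq_faceForm` the restriction of `F(t)` to the plane `v₀^⊥` is
INDEFINITE.  (By relabelling, the same for every node: all four node-plane restrictions are indefinite at such a root.) [folklore] -/
theorem faceForm_neg_of_root (c₀ c₁ c₂ c₃ ℓ₀ ℓ₁ ℓ₂ ℓ₃ : ℝ) (hc : 0 < c₀) (h₀ : ℓ₀ ≠ 0) (he : 0 < ℓ₀ * ℓ₁ * ℓ₂ * ℓ₃)
    (hK : c₀ * (ℓ₁ * ℓ₂ * ℓ₃) + c₁ * (ℓ₀ * ℓ₂ * ℓ₃) + c₂ * (ℓ₀ * ℓ₁ * ℓ₃) + c₃ * (ℓ₀ * ℓ₁ * ℓ₂) = 0) :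
    c₁ * (ℓ₂ * ℓ₃) + c₂ * (ℓ₁ * ℓ₃) + c₃ * (ℓ₁ * ℓ₂) < 0 := by
  have h := faceForm_mul_sq_of_root c₀ c₁ c₂ c₃ ℓ₀ ℓ₁ ℓ₂ ℓ₃ hK
  have hsq : 0 < ℓ₀ ^ 2 := by positivity
  have hneg : (c₁ * (ℓ₂ * ℓ₃) + c₂ * (ℓ₁ * ℓ₃) + c₃ * (ℓ₁ * ℓ₂)) * ℓ₀ ^ 2 < 0 := by
    rw [h]; exact neg_neg_of_pos (mul_pos hc he)
  by_contra hnn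
  exact absurd hneg (not_lt.mpr (mul_nonneg (not_lt.mp hnn) hsq.le))

/-- **All faces positive in an odd chamber.**  At a det-root with `c₀ > 0`, `ℓ₀ ≠ 0` and `ℓ₀ℓ₁ℓ₂ℓ₃ < 0` (one or three negative node
values), the face form opposite node `0` is POSITIVE — the restriction of `F(t)` to `v₀^⊥` is DEFINITE (and likewise at every node).
[folklore] -/
theorem faceForm_pos_of_root (c₀ c₁ c₂ c₃ ℓ₀ ℓ₁ ℓ₂ ℓ₃ : ℝ) (hc : 0 < c₀) (h₀ : ℓ₀ ≠ 0) (he : ℓ₀ * ℓ₁ * ℓ₂ * ℓ₃ < 0)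
    (hK : c₀ * (ℓ₁ * ℓ₂ * ℓ₃) + c₁ * (ℓ₀ * ℓ₂ * ℓ₃) + c₂ * (ℓ₀ * ℓ₁ * ℓ₃) + c₃ * (ℓ₀ * ℓ₁ * ℓ₂) = 0) :
    0 < c₁ * (ℓ₂ * ℓ₃) + c₂ * (ℓ₁ * ℓ₃) + c₃ * (ℓ₁ * ℓ₂) := by
  have h := faceForm_mul_sq_of_root c₀ c₁ c₂ c₃ ℓ₀ ℓ₁ ℓ₂ ℓ₃ hK
  have hsq : 0 < ℓ₀ ^ 2 := by positivity
  have hpos : 0 < (c₁ * (ℓ₂ * ℓ₃) + c₂ * (ℓ₁ * ℓ₃) + c₃ * (ℓ₁ * ℓ₂)) * ℓ₀ ^ 2 := by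
    rw [h]; exact neg_pos.mpr (mul_neg_of_pos_of_neg hc he)
  by_contra hnn
  exact absurd hpos (not_lt.mpr (mul_nonpos_of_nonpos_of_nonneg (not_lt.mp hnn) hsq.le))

/-- Face law I with the face value isolated (off the wall `ℓ₀ = 0`): `face₀ = (K_c · ℓ₀ − c₀ · e₄) / ℓ₀²`, so along a pencil the face
opposite node `0` is determined by `det F`, the node form `ℓ₀` and the product `e₄` of the node forms. [folklore] -/
theorem faceForm_eq_div (c₀ c₁ c₂ c₃ ℓ₀ ℓ₁ ℓ₂ ℓ₃ : ℝ) (h₀ : ℓ₀ ≠ 0) :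
    c₁ * (ℓ₂ * ℓ₃) + c₂ * (ℓ₁ * ℓ₃) + c₃ * (ℓ₁ * ℓ₂) =
      ((c₀ * (ℓ₁ * ℓ₂ * ℓ₃) + c₁ * (ℓ₀ * ℓ₂ * ℓ₃) + c₂ * (ℓ₀ * ℓ₁ * ℓ₃) + c₃ * (ℓ₀ * ℓ₁ * ℓ₂)) * ℓ₀
        - c₀ * (ℓ₀ * ℓ₁ * ℓ₂ * ℓ₃)) / ℓ₀ ^ 2 := by
  rw [← faceForm_mul_sq, mul_div_assoc, div_self (pow_ne_zero 2 h₀), mul_one]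

/-! ## 3. Face law II: two faces sharing an edge -/

/-- **FACE LAW II** (a `ring` identity).  The faces opposite nodes `3` and `2` share the edge `{0,1}`; their product is
`face₃ · face₂ = (c₁ℓ₀ + c₀ℓ₁) · K_c(ℓ) + c₂c₃ · ℓ₀²ℓ₁²`  (unit weights: `e₂(ℓ₀,ℓ₁,ℓ₂)·e₂(ℓ₀,ℓ₁,ℓ₃) = (ℓ₀+ℓ₁)·e₃ + (ℓ₀ℓ₁)²`).
[folklore] -/
theorem faceForm_pair (c₀ c₁ c₂ c₃ ℓ₀ ℓ₁ ℓ₂ ℓ₃ : ℝ) :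
    (c₀ * (ℓ₁ * ℓ₂) + c₁ * (ℓ₀ * ℓ₂) + c₂ * (ℓ₀ * ℓ₁)) * (c₀ * (ℓ₁ * ℓ₃) + c₁ * (ℓ₀ * ℓ₃) + c₃ * (ℓ₀ * ℓ₁)) =
      (c₁ * ℓ₀ + c₀ * ℓ₁) * (c₀ * (ℓ₁ * ℓ₂ * ℓ₃) + c₁ * (ℓ₀ * ℓ₂ * ℓ₃) + c₂ * (ℓ₀ * ℓ₁ * ℓ₃) + c₃ * (ℓ₀ * ℓ₁ * ℓ₂))
        + c₂ * c₃ * (ℓ₀ ^ 2 * ℓ₁ ^ 2) := by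
  ring

/-- At a det-root the product of two faces sharing an edge is the explicit non-negative quantity `c₂c₃ℓ₀²ℓ₁²`. [folklore] -/
theorem faceForm_pair_of_root (c₀ c₁ c₂ c₃ ℓ₀ ℓ₁ ℓ₂ ℓ₃ : ℝ)
    (hK : c₀ * (ℓ₁ * ℓ₂ * ℓ₃) + c₁ * (ℓ₀ * ℓ₂ * ℓ₃) + c₂ * (ℓ₀ * ℓ₁ * ℓ₃) + c₃ * (ℓ₀ * ℓ₁ * ℓ₂) = 0) :
    (c₀ * (ℓ₁ * ℓ₂) + c₁ * (ℓ₀ * ℓ₂) + c₂ * (ℓ₀ * ℓ₁)) * (c₀ * (ℓ₁ * ℓ₃) + c₁ * (ℓ₀ * ℓ₃) + c₃ * (ℓ₀ * ℓ₁)) =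
      c₂ * c₃ * (ℓ₀ ^ 2 * ℓ₁ ^ 2) := by
  rw [faceForm_pair, hK, mul_zero, zero_add]

/-- Off the walls and with positive weights, two faces sharing an edge have a POSITIVE product at every det-root (same strict sign).
[folklore] -/
theorem faceForm_pair_pos_of_root (c₀ c₁ c₂ c₃ ℓ₀ ℓ₁ ℓ₂ ℓ₃ : ℝ) (h₂ : 0 < c₂) (h₃ : 0 < c₃) (h₀ : ℓ₀ ≠ 0) (h₁ : ℓ₁ ≠ 0)
    (hK : c₀ * (ℓ₁ * ℓ₂ * ℓ₃) + c₁ * (ℓ₀ * ℓ₂ * ℓ₃) + c₂ * (ℓ₀ * ℓ₁ * ℓ₃) + c₃ * (ℓ₀ * ℓ₁ * ℓ₂) = 0) :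
    0 < (c₀ * (ℓ₁ * ℓ₂) + c₁ * (ℓ₀ * ℓ₂) + c₂ * (ℓ₀ * ℓ₁)) * (c₀ * (ℓ₁ * ℓ₃) + c₁ * (ℓ₀ * ℓ₃) + c₃ * (ℓ₀ * ℓ₁)) := by
  rw [faceForm_pair_of_root c₀ c₁ c₂ c₃ ℓ₀ ℓ₁ ℓ₂ ℓ₃ hK]
  have : 0 < ℓ₀ ^ 2 * ℓ₁ ^ 2 := by positivity
  positivity

/-! ## 4. The three-node chart of Cayley's cubic -/

/-- **THREE-NODE CHART** (a `ring` identity).  With the shifted node forms `Lᵢ = c₀ℓᵢ + cᵢℓ₀` (`i = 1,2,3`) and the single form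
`Λ = c₂c₃L₁ + c₁c₃L₂ + c₁c₂L₃ − 2c₁c₂c₃ℓ₀`:  `c₀² · K_c(ℓ) = L₁L₂L₃ − ℓ₀² · Λ`.  Cayley's four-node sum is «a product of three
`K`-nomials minus `ℓ₀²` times one `K`-nomial»: the member `λ = Λ` of the linear family `L₁L₂L₃ − ℓ₀²·λ` of cubics of partial degree
`≤ 1` in `L₁, L₂, L₃` (three nodes); the fourth node is the single condition on `λ`. [folklore] -/
theorem threeNodeChart (c₀ c₁ c₂ c₃ ℓ₀ ℓ₁ ℓ₂ ℓ₃ : ℝ) :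
    c₀ ^ 2 * (c₀ * (ℓ₁ * ℓ₂ * ℓ₃) + c₁ * (ℓ₀ * ℓ₂ * ℓ₃) + c₂ * (ℓ₀ * ℓ₁ * ℓ₃) + c₃ * (ℓ₀ * ℓ₁ * ℓ₂)) =
      (c₀ * ℓ₁ + c₁ * ℓ₀) * (c₀ * ℓ₂ + c₂ * ℓ₀) * (c₀ * ℓ₃ + c₃ * ℓ₀)
        - ℓ₀ ^ 2 * (c₂ * c₃ * (c₀ * ℓ₁ + c₁ * ℓ₀) + c₁ * c₃ * (c₀ * ℓ₂ + c₂ * ℓ₀) + c₁ * c₂ * (c₀ * ℓ₃ + c₃ * ℓ₀)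
            - 2 * (c₁ * c₂ * c₃) * ℓ₀) := by
  ring

/-- At a det-root: `L₁L₂L₃ = ℓ₀² · Λ` — the product of the three shifted node forms equals `ℓ₀²` times the single form `Λ`, so (off the
wall `ℓ₀ = 0`) it has the sign of `Λ`. [folklore] -/
theorem threeNodeChart_of_root (c₀ c₁ c₂ c₃ ℓ₀ ℓ₁ ℓ₂ ℓ₃ : ℝ)
    (hK : c₀ * (ℓ₁ * ℓ₂ * ℓ₃) + c₁ * (ℓ₀ * ℓ₂ * ℓ₃) + c₂ * (ℓ₀ * ℓ₁ * ℓ₃) + c₃ * (ℓ₀ * ℓ₁ * ℓ₂) = 0) :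
    (c₀ * ℓ₁ + c₁ * ℓ₀) * (c₀ * ℓ₂ + c₂ * ℓ₀) * (c₀ * ℓ₃ + c₃ * ℓ₀) =
      ℓ₀ ^ 2 * (c₂ * c₃ * (c₀ * ℓ₁ + c₁ * ℓ₀) + c₁ * c₃ * (c₀ * ℓ₂ + c₂ * ℓ₀) + c₁ * c₂ * (c₀ * ℓ₃ + c₃ * ℓ₀)
        - 2 * (c₁ * c₂ * c₃) * ℓ₀) := by
  have h := threeNodeChart c₀ c₁ c₂ c₃ ℓ₀ ℓ₁ ℓ₂ ℓ₃
  rw [hK, mul_zero] at h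
  linarith

/-- The sign form of the three-node chart at a det-root off the wall `ℓ₀ = 0`: `0 < L₁L₂L₃ ↔ 0 < Λ`. [folklore] -/
theorem threeNodeChart_sign_of_root (c₀ c₁ c₂ c₃ ℓ₀ ℓ₁ ℓ₂ ℓ₃ : ℝ) (h₀ : ℓ₀ ≠ 0)
    (hK : c₀ * (ℓ₁ * ℓ₂ * ℓ₃) + c₁ * (ℓ₀ * ℓ₂ * ℓ₃) + c₂ * (ℓ₀ * ℓ₁ * ℓ₃) + c₃ * (ℓ₀ * ℓ₁ * ℓ₂) = 0) :
    0 < (c₀ * ℓ₁ + c₁ * ℓ₀) * (c₀ * ℓ₂ + c₂ * ℓ₀) * (c₀ * ℓ₃ + c₃ * ℓ₀) ↔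
      0 < c₂ * c₃ * (c₀ * ℓ₁ + c₁ * ℓ₀) + c₁ * c₃ * (c₀ * ℓ₂ + c₂ * ℓ₀) + c₁ * c₂ * (c₀ * ℓ₃ + c₃ * ℓ₀)
        - 2 * (c₁ * c₂ * c₃) * ℓ₀ := by
  rw [threeNodeChart_of_root c₀ c₁ c₂ c₃ ℓ₀ ℓ₁ ℓ₂ ℓ₃ hK]
  have hsq : 0 < ℓ₀ ^ 2 := by positivity
  constructor
  · intro h
    by_contra hn
    exact absurd h (not_lt.mpr (mul_nonpos_of_nonneg_of_nonpos hsq.le (not_lt.mp hn)))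
  · intro h
    positivity

/-! ## 5. Pencil form: the face laws along a four-node pencil -/

/-- **Face law I along a pencil.**  For a pencil with rank-one-generated letters `S l = ∑ᵢ A i l • vᵢvᵢᵀ` (node `K`-nomials
`ℓᵢ(t) = ∑ₗ A i l t^(d l)`, squared weights `Cᵢ²` as in `…NodeForm.det_sum_four_rankOne`), at every det-root `t` with `ℓ₀(t) ≠ 0` lying
in an EVEN node chamber (`ℓ₀ℓ₁ℓ₂ℓ₃(t) > 0`) and with the three nodes `v₁, v₂, v₃` independent (`C₀ ≠ 0`), the face form opposite the
node `v₀` — the determinant of `F(t)` restricted to the plane `v₀^⊥` — is NEGATIVE. [folklore] -/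
theorem pencil_faceForm_neg_of_root {K : ℕ} (d : Fin K → ℕ) (A : Fin 4 → Fin K → ℝ) (v : Fin 4 → Fin 3 → ℝ) (t : ℝ)
    (hC : v 1 0 * (v 2 1 * v 3 2 - v 3 1 * v 2 2) - v 2 0 * (v 1 1 * v 3 2 - v 3 1 * v 1 2)
        + v 3 0 * (v 1 1 * v 2 2 - v 2 1 * v 1 2) ≠ 0)
    (hroot : (∑ i, (∑ l, A i l * t ^ d l) • Matrix.vecMulVec (v i) (v i)).det = 0)
    (h₀ : ∑ l, A 0 l * t ^ d l ≠ 0)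
    (he : 0 < (∑ l, A 0 l * t ^ d l) * (∑ l, A 1 l * t ^ d l) * (∑ l, A 2 l * t ^ d l) * (∑ l, A 3 l * t ^ d l)) :
    (v 0 0 * (v 2 1 * v 3 2 - v 3 1 * v 2 2) - v 2 0 * (v 0 1 * v 3 2 - v 3 1 * v 0 2)
          + v 3 0 * (v 0 1 * v 2 2 - v 2 1 * v 0 2)) ^ 2 * ((∑ l, A 2 l * t ^ d l) * (∑ l, A 3 l * t ^ d l))
      + (v 0 0 * (v 1 1 * v 3 2 - v 3 1 * v 1 2) - v 1 0 * (v 0 1 * v 3 2 - v 3 1 * v 0 2)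
          + v 3 0 * (v 0 1 * v 1 2 - v 1 1 * v 0 2)) ^ 2 * ((∑ l, A 1 l * t ^ d l) * (∑ l, A 3 l * t ^ d l))
      + (v 0 0 * (v 1 1 * v 2 2 - v 2 1 * v 1 2) - v 1 0 * (v 0 1 * v 2 2 - v 2 1 * v 0 2)
          + v 2 0 * (v 0 1 * v 1 2 - v 1 1 * v 0 2)) ^ 2 * ((∑ l, A 1 l * t ^ d l) * (∑ l, A 2 l * t ^ d l)) < 0 := by
  rw [det_sum_four_rankOne] at hroot
  set ℓ₀ := ∑ l, A 0 l * t ^ d l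
  set ℓ₁ := ∑ l, A 1 l * t ^ d l
  set ℓ₂ := ∑ l, A 2 l * t ^ d l
  set ℓ₃ := ∑ l, A 3 l * t ^ d l
  set C₀ := v 1 0 * (v 2 1 * v 3 2 - v 3 1 * v 2 2) - v 2 0 * (v 1 1 * v 3 2 - v 3 1 * v 1 2)
      + v 3 0 * (v 1 1 * v 2 2 - v 2 1 * v 1 2)
  set C₁ := v 0 0 * (v 2 1 * v 3 2 - v 3 1 * v 2 2) - v 2 0 * (v 0 1 * v 3 2 - v 3 1 * v 0 2)
      + v 3 0 * (v 0 1 * v 2 2 - v 2 1 * v 0 2)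
  set C₂ := v 0 0 * (v 1 1 * v 3 2 - v 3 1 * v 1 2) - v 1 0 * (v 0 1 * v 3 2 - v 3 1 * v 0 2)
      + v 3 0 * (v 0 1 * v 1 2 - v 1 1 * v 0 2)
  set C₃ := v 0 0 * (v 1 1 * v 2 2 - v 2 1 * v 1 2) - v 1 0 * (v 0 1 * v 2 2 - v 2 1 * v 0 2)
      + v 2 0 * (v 0 1 * v 1 2 - v 1 1 * v 0 2)
  exact faceForm_neg_of_root (C₀ ^ 2) (C₁ ^ 2) (C₂ ^ 2) (C₃ ^ 2) ℓ₀ ℓ₁ ℓ₂ ℓ₃ (by positivity) h₀ he hroot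

/-- **… and in an ODD node chamber (`ℓ₀ℓ₁ℓ₂ℓ₃(t) < 0`) the face opposite `v₀` is POSITIVE** (the restriction of `F(t)` to `v₀^⊥` is
definite).  By relabelling the nodes both statements hold at every node: at a det-root all four node-plane restrictions of `F(t)` have
non-zero determinants of ONE sign, `−sign(ℓ₀ℓ₁ℓ₂ℓ₃(t))`. [folklore] -/
theorem pencil_faceForm_pos_of_root {K : ℕ} (d : Fin K → ℕ) (A : Fin 4 → Fin K → ℝ) (v : Fin 4 → Fin 3 → ℝ) (t : ℝ)
    (hC : v 1 0 * (v 2 1 * v 3 2 - v 3 1 * v 2 2) - v 2 0 * (v 1 1 * v 3 2 - v 3 1 * v 1 2)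
        + v 3 0 * (v 1 1 * v 2 2 - v 2 1 * v 1 2) ≠ 0)
    (hroot : (∑ i, (∑ l, A i l * t ^ d l) • Matrix.vecMulVec (v i) (v i)).det = 0)
    (h₀ : ∑ l, A 0 l * t ^ d l ≠ 0)
    (he : (∑ l, A 0 l * t ^ d l) * (∑ l, A 1 l * t ^ d l) * (∑ l, A 2 l * t ^ d l) * (∑ l, A 3 l * t ^ d l) < 0) :
    0 < (v 0 0 * (v 2 1 * v 3 2 - v 3 1 * v 2 2) - v 2 0 * (v 0 1 * v 3 2 - v 3 1 * v 0 2)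
          + v 3 0 * (v 0 1 * v 2 2 - v 2 1 * v 0 2)) ^ 2 * ((∑ l, A 2 l * t ^ d l) * (∑ l, A 3 l * t ^ d l))
      + (v 0 0 * (v 1 1 * v 3 2 - v 3 1 * v 1 2) - v 1 0 * (v 0 1 * v 3 2 - v 3 1 * v 0 2)
          + v 3 0 * (v 0 1 * v 1 2 - v 1 1 * v 0 2)) ^ 2 * ((∑ l, A 1 l * t ^ d l) * (∑ l, A 3 l * t ^ d l))
      + (v 0 0 * (v 1 1 * v 2 2 - v 2 1 * v 1 2) - v 1 0 * (v 0 1 * v 2 2 - v 2 1 * v 0 2)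
          + v 2 0 * (v 0 1 * v 1 2 - v 1 1 * v 0 2)) ^ 2 * ((∑ l, A 1 l * t ^ d l) * (∑ l, A 2 l * t ^ d l)) := by
  rw [det_sum_four_rankOne] at hroot
  set ℓ₀ := ∑ l, A 0 l * t ^ d l
  set ℓ₁ := ∑ l, A 1 l * t ^ d l
  set ℓ₂ := ∑ l, A 2 l * t ^ d l
  set ℓ₃ := ∑ l, A 3 l * t ^ d l
  set C₀ := v 1 0 * (v 2 1 * v 3 2 - v 3 1 * v 2 2) - v 2 0 * (v 1 1 * v 3 2 - v 3 1 * v 1 2)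
      + v 3 0 * (v 1 1 * v 2 2 - v 2 1 * v 1 2)
  set C₁ := v 0 0 * (v 2 1 * v 3 2 - v 3 1 * v 2 2) - v 2 0 * (v 0 1 * v 3 2 - v 3 1 * v 0 2)
      + v 3 0 * (v 0 1 * v 2 2 - v 2 1 * v 0 2)
  set C₂ := v 0 0 * (v 1 1 * v 3 2 - v 3 1 * v 1 2) - v 1 0 * (v 0 1 * v 3 2 - v 3 1 * v 0 2)
      + v 3 0 * (v 0 1 * v 1 2 - v 1 1 * v 0 2)
  set C₃ := v 0 0 * (v 1 1 * v 2 2 - v 2 1 * v 1 2) - v 1 0 * (v 0 1 * v 2 2 - v 2 1 * v 0 2)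
      + v 2 0 * (v 0 1 * v 1 2 - v 1 1 * v 0 2)
  exact faceForm_pos_of_root (C₀ ^ 2) (C₁ ^ 2) (C₂ ^ 2) (C₃ ^ 2) ℓ₀ ℓ₁ ℓ₂ ℓ₃ (by positivity) h₀ he hroot

end Summit.ValiantsHypothesis.ValiantsHypothesis.Theorems.LacunarySymmetroidMatrixDescartes.Census.NodeFaces
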